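import Summits.QuantumFields.QCD.Theses.NestedDissectionSea
import Summits.QuantumFields.QCD.Theorems.EarlyCrosserLaw.Negative.LowerPinLoadBearing

/-!
# Crux `LightQuarkCompletion` (stmt-QuantumFields-18066, route NestedDissectionSea, rank 6), negative side, 1/2 —
# anatomy, refutation window, and the three idle hypotheses

Support file of the standing disprover (refuter-cdisprove-stmt-QuantumFields-18066-0, cycle 1, 2026-08-17; extract of
`Cruxes/LightQuarkCompletion/Disproof.lean` §1–§3).  NO refutation — the crux survives.  Sorry-free, standard axioms; written
over the sibling disprovers' VERBATIM clause abbreviations `CoerciveSeaNegative.PinClause` (lower pin (b)) and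
`EarlyCrosserLawNegative.UpperPin` (upper pin (b″)), so nothing is duplicated.  The `def`s are statement abbreviations for the
analysis (the crux's own clauses and their hypothesis-deleted variants), not facts; nothing asserts a Theses decl.

* §1 `lightQuarkCompletion_iff` / `_iff_exists`: the crux is `∀ Nf ∈ {2,3}, (∃ reg M₀, HypAt) → Concl Nf` with a `reg`-FREE
  conclusion, and `concl_qcdOf : Concl Nf → QCDOf Nf`.
* §2 `not_lightQuarkCompletion_iff`: THE REFUTATION WINDOW — a disproof must construct pinned threshold QCD AND refute
  `Concl ⊇ QCDOf`; neither half has a junk instance (the body needs IsQCDAlong-tied non-trivial OS data and an honest uniform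
  lattice gap; a lower pin needs a phase-quenched sign probability `≥ 1/4`, and Seiler positivity — the one closed-form
  evaluation in the tree — can only EMPTY the event).
* §3 THREE IDLE HYPOTHESES: `lightQuarkCompletion_iff_withoutHAS` (the body carries asymptotic scaling),
  `lightQuarkCompletion_iff_withoutSign` (`0 ≤ M₀`, monotonicity), `lightQuarkCompletion_iff_withoutBranch` (the weak branch
  `∀ᶠ k, −1 ≤ m_crit k`: the whole package is covariant under the RGI up-shift `upShift reg D`, `m_crit ↦ m_crit + a D/Z_m` —
  `pinClause_upShift`, `upperPin_upShift`, `body_upShift` — and after shifting by `M₀ + 1` the body's own IsQCDAlong branch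
  clause supplies the branch, `body_branch_upShift`).  The remaining hypotheses (`N_f ∈ {2,3}`, `HasMassScaling`, pin, body)
  can be shown neither idle nor load-bearing in Lean: the conclusion is `reg`-free and QCD-hard on both sides.
Companion file 2/2 (`LineSketchLoadBearing.lean`): the load-bearing hypotheses of the stubs of line `Sketch`.
-/

noncomputable section

open scoped BigOperators Classical
open MeasureTheory Filter Topology Matrix
open Literature.MathematicalPhysics.QuantumLattice Literature.MathematicalPhysics.QuantumFieldTheory
  Literature.Probability.LatticeModels
open Summit.QuantumFields.QCD.Theses.NestedDissectionSea
open Summit.QuantumFields.QCD.Theorems.CoerciveSeaNegative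
open Summit.QuantumFields.QCD.Theorems.EarlyCrosserLawNegative

namespace Summit.QuantumFields.QCD.Theorems.LightQuarkCompletion.Negative

variable {Nf : ℕ}

/-! ## §1 Anatomy: verbatim abbreviations and the `reg`-free conclusion -/

/-- **The two-sided parity pin above threshold `M₀`** (hypothesis 5 of the crux at `M₀`, conjunct 4 of its conclusion at
`0`), VERBATIM over the tree's `PinClause` (lower pin (b)) and `UpperPin` (upper pin (b″)).  Statement abbreviation. -/
def PinPkg (Nf : ℕ) (reg : QCDRegularisation Nf) (M₀ : ℝ) : Prop :=
  ∀ m : Fin Nf → ℝ, (∀ f, M₀ < m f) → ∃ R : ℝ, 0 < R ∧ PinClause Nf reg M₀ m R ∧ UpperPin Nf reg M₀ m R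

/-- **The `QCDOf` body above threshold `M₀`** (hypothesis 6 of the crux at `M₀`, last conjunct of its conclusion at `0`),
VERBATIM.  Statement abbreviation. -/
def Body (Nf : ℕ) (reg : QCDRegularisation Nf) (M₀ : ℝ) : Prop :=
  ∀ m : Fin Nf → ℝ, (∀ f, M₀ < m f) → ∃ (z shift : QCDField Nf → ℕ → ℝ) (T : OSData (QCDField Nf) 4),
    IsQCDAlong (reg.scheme m z shift) T ∧ T.IsNontrivial QCDField.glue ∧ T.IsNonGaussian QCDField.glue ∧
      (∀ f g : Fin Nf, f ≠ g → T.IsNontrivial (QCDField.pseudoRe f g)) ∧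
        ∃ Δ > 0, T.HasMassGap Δ ∧ (reg.scheme m z shift).HasLatticeMassGap Δ

/-- **The hypothesis package of the crux at `(reg, M₀)`**, VERBATIM: mass scaling, asymptotic scaling, weak branch,
`0 ≤ M₀`, the pin above `M₀`, the body above `M₀`.  Statement abbreviation. -/
def HypAt (Nf : ℕ) (reg : QCDRegularisation Nf) (M₀ : ℝ) : Prop :=
  reg.HasMassScaling ∧ (reg.scheme 0 0 0).HasAsymptoticScaling ∧ (∀ᶠ k : ℕ in atTop, -1 ≤ reg.mcrit k) ∧ 0 ≤ M₀ ∧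
    PinPkg Nf reg M₀ ∧ Body Nf reg M₀

/-- **The conclusion of the crux at `N_f`**, VERBATIM: some regularisation with both scalings, `m_crit' → 0`, the pin at ZERO
threshold, chiral at zero, and the body at every positive tuple.  It does not mention the hypothesis' `reg`.  Statement
abbreviation. -/
def Concl (Nf : ℕ) : Prop :=
  ∃ reg' : QCDRegularisation Nf, reg'.HasMassScaling ∧ (reg'.scheme 0 0 0).HasAsymptoticScaling ∧
    Tendsto reg'.mcrit atTop (𝓝 0) ∧ PinPkg Nf reg' 0 ∧ reg'.IsChiralAtZero ∧ Body Nf reg' 0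

/-- **The crux IS `∀ Nf ∈ {2,3}, ∀ reg M₀, HypAt → Concl`** (definitional unfolding; certifies the abbreviations are verbatim). [folklore] -/
theorem lightQuarkCompletion_iff :
    LightQuarkCompletion ↔ ∀ Nf : ℕ, (Nf = 2 ∨ Nf = 3) → ∀ (reg : QCDRegularisation Nf) (M₀ : ℝ),
      HypAt Nf reg M₀ → Concl Nf := by
  constructor
  · intro h Nf hNf reg M₀ hH
    obtain ⟨hMS, hAS, hbr, hM₀, hpin, hbody⟩ := hH
    exact h Nf hNf reg hMS hAS hbr M₀ hM₀ hpin hbody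
  · intro h Nf hNf reg hMS hAS hbr M₀ hM₀ hpin hbody
    exact h Nf hNf reg M₀ ⟨hMS, hAS, hbr, hM₀, hpin, hbody⟩

/-- **The conclusion is `reg`-free**: the crux is the implication "threshold package inhabited → `Concl`". [folklore] -/
theorem lightQuarkCompletion_iff_exists :
    LightQuarkCompletion ↔ ∀ Nf : ℕ, (Nf = 2 ∨ Nf = 3) →
      (∃ (reg : QCDRegularisation Nf) (M₀ : ℝ), HypAt Nf reg M₀) → Concl Nf := by
  rw [lightQuarkCompletion_iff]
  constructor
  · rintro h Nf hNf ⟨reg, M₀, hH⟩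
    exact h Nf hNf reg M₀ hH
  · intro h Nf hNf reg M₀ hH
    exact h Nf hNf ⟨reg, M₀, hH⟩

/-- **`Concl Nf` implies the summit conjunct `QCDOf Nf`** (forget asymptotic scaling, `m_crit' → 0` and the pin). [folklore] -/
theorem concl_qcdOf (h : Concl Nf) : QCDOf Nf := by
  obtain ⟨reg', hMS, -, -, -, hχ, hbody⟩ := h
  exact ⟨reg', hMS, hχ, hbody⟩

/-! ## §2 The refutation window -/

/-- **THE WINDOW.**  `LightQuarkCompletion` fails iff at `N_f = 2` or `3` the threshold package is INHABITED (a construction of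
pinned threshold QCD: both scalings, weak branch, two-sided parity pin and `QCDOf` body above some `M₀ ≥ 0`) and `Concl N_f`
FAILS (no zero-threshold-pinned chiral regularisation carries the body at all positive masses).  Neither half has a junk
instance: the body needs IsQCDAlong-tied OS data with non-trivial non-Gaussian glue and an honest uniform lattice gap; a lower
pin needs a phase-quenched sign probability `≥ 1/4`, which no closed-form evaluation in the tree provides (Seiler positivity
only EMPTIES the event off `(−8, 0)`); and `¬ Concl` contains `¬`(pinned chiral QCD). [folklore] -/
theorem not_lightQuarkCompletion_iff :
    ¬ LightQuarkCompletion ↔ ∃ Nf : ℕ, (Nf = 2 ∨ Nf = 3) ∧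
      (∃ (reg : QCDRegularisation Nf) (M₀ : ℝ), HypAt Nf reg M₀) ∧ ¬ Concl Nf := by
  rw [lightQuarkCompletion_iff_exists]
  push Not
  rfl

/-- **A disproof through the summit conjunct**: inhabiting the threshold package at `N_f` and refuting `QCDOf N_f` refutes the
crux (the converse fails: `Concl` is stronger than `QCDOf`). [folklore] -/
theorem not_lightQuarkCompletion_of_not_qcdOf (hNf : Nf = 2 ∨ Nf = 3)
    (hpkg : ∃ (reg : QCDRegularisation Nf) (M₀ : ℝ), HypAt Nf reg M₀) (hQ : ¬ QCDOf Nf) : ¬ LightQuarkCompletion :=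
  not_lightQuarkCompletion_iff.mpr ⟨Nf, hNf, hpkg, fun h => hQ (concl_qcdOf h)⟩

/-! ## §3 Load-bearing analysis of the hypotheses

Three hypotheses are IDLE (the crux with the hypothesis deleted is EQUIVALENT to the crux): asymptotic scaling, `0 ≤ M₀`, the
weak branch.  The mechanism for the branch is the RGI up-shift `upShift reg D` (`m_crit ↦ m_crit + a D / Z_m`), under which the
scheme at tuple `m` is the scheme at `D + m`, the pin above `M₀` becomes the pin above `M₀ + D`, and the body above `M₀` becomes
the body above `M₀ − D`. -/

/-- The body forces asymptotic scaling of `reg.scheme 0 0 0` (IsQCDAlong's first clause reads only `β, a`). [folklore] -/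
theorem body_hasAsymptoticScaling {reg : QCDRegularisation Nf} {M₀ : ℝ} (h : Body Nf reg M₀) :
    (reg.scheme 0 0 0).HasAsymptoticScaling := by
  obtain ⟨z, shift, T, hQ, -⟩ := h (fun _ => M₀ + 1) (fun _ => by linarith)
  exact hQ.1

/-- The body forces the branch clause of every realised bare trajectory above `M₀` (IsQCDAlong's second clause): for every
tuple `m > M₀` and flavour `f`, eventually `−1 < m_crit k + a_k m_f / Z_m k`.  The crux's weak-branch hypothesis
`∀ᶠ k, −1 ≤ m_crit k` is this up to the sliver `a_k (M₀ + ε)/Z_m k → 0`. [folklore] -/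
theorem body_branch_sliver {reg : QCDRegularisation Nf} {M₀ : ℝ} (h : Body Nf reg M₀) (m : Fin Nf → ℝ)
    (hm : ∀ f, M₀ < m f) (f : Fin Nf) : ∀ᶠ k : ℕ in atTop, -1 < reg.mcrit k + reg.a k * m f / reg.Zm k := by
  obtain ⟨z, shift, T, hQ, -⟩ := h m hm
  exact hQ.2.1 f

/-- The pin above `M₀` is the pin above every `M₁ ≥ M₀`. [folklore] -/
theorem pinPkg_mono {reg : QCDRegularisation Nf} {M₀ M₁ : ℝ} (h : PinPkg Nf reg M₀) (hle : M₀ ≤ M₁) :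
    PinPkg Nf reg M₁ := by
  intro m hm
  obtain ⟨R, hR, hlo, hup⟩ := h m fun f => lt_of_le_of_lt hle (hm f)
  exact ⟨R, hR, fun M hM => hlo M (lt_of_le_of_lt hle hM), fun M hM => hup M (lt_of_le_of_lt hle hM)⟩

/-- The body above `M₀` is the body above every `M₁ ≥ M₀`. [folklore] -/
theorem body_mono {reg : QCDRegularisation Nf} {M₀ M₁ : ℝ} (h : Body Nf reg M₀) (hle : M₀ ≤ M₁) : Body Nf reg M₁ :=
  fun m hm => h m fun f => lt_of_le_of_lt hle (hm f)

/-- **`HasAsymptoticScaling` is idle**: the crux with hypothesis 2 deleted. -/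
def WithoutHAS : Prop :=
  ∀ Nf : ℕ, (Nf = 2 ∨ Nf = 3) → ∀ reg : QCDRegularisation Nf, reg.HasMassScaling →
    (∀ᶠ k : ℕ in atTop, -1 ≤ reg.mcrit k) → ∀ M₀ : ℝ, 0 ≤ M₀ → PinPkg Nf reg M₀ → Body Nf reg M₀ → Concl Nf

/-- `LightQuarkCompletion ↔ WithoutHAS` (the body supplies the deleted hypothesis). [folklore] -/
theorem lightQuarkCompletion_iff_withoutHAS : LightQuarkCompletion ↔ WithoutHAS := by
  rw [lightQuarkCompletion_iff]
  constructor
  · intro h Nf hNf reg hMS hbr M₀ hM₀ hpin hbody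
    exact h Nf hNf reg M₀ ⟨hMS, body_hasAsymptoticScaling hbody, hbr, hM₀, hpin, hbody⟩
  · rintro h Nf hNf reg M₀ ⟨hMS, -, hbr, hM₀, hpin, hbody⟩
    exact h Nf hNf reg hMS hbr M₀ hM₀ hpin hbody

/-- **`0 ≤ M₀` is idle**: the crux with hypothesis 4 deleted (any real threshold). -/
def WithoutSign : Prop :=
  ∀ Nf : ℕ, (Nf = 2 ∨ Nf = 3) → ∀ reg : QCDRegularisation Nf, reg.HasMassScaling →
    (reg.scheme 0 0 0).HasAsymptoticScaling → (∀ᶠ k : ℕ in atTop, -1 ≤ reg.mcrit k) → ∀ M₀ : ℝ,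
      PinPkg Nf reg M₀ → Body Nf reg M₀ → Concl Nf

/-- `LightQuarkCompletion ↔ WithoutSign` (raise a negative threshold to `0` by monotonicity). [folklore] -/
theorem lightQuarkCompletion_iff_withoutSign : LightQuarkCompletion ↔ WithoutSign := by
  rw [lightQuarkCompletion_iff]
  constructor
  · intro h Nf hNf reg hMS hAS hbr M₀ hpin hbody
    exact h Nf hNf reg (max M₀ 0)
      ⟨hMS, hAS, hbr, le_max_right _ _, pinPkg_mono hpin (le_max_left _ _), body_mono hbody (le_max_left _ _)⟩
  · rintro h Nf hNf reg M₀ ⟨hMS, hAS, hbr, -, hpin, hbody⟩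
    exact h Nf hNf reg hMS hAS hbr M₀ hpin hbody

/-! ### The RGI up-shift and the idleness of the weak branch -/

/-- **The RGI up-shift** of a regularisation by `D`: `m_crit(k) ↦ m_crit(k) + a_k D / Z_m(k)`, all other data kept. -/
def upShift (reg : QCDRegularisation Nf) (D : ℝ) : QCDRegularisation Nf :=
  { reg with mcrit := fun k => reg.mcrit k + reg.a k * D / reg.Zm k }

/-- The up-shift keeps the spacings. [folklore] -/
@[simp] theorem upShift_a (reg : QCDRegularisation Nf) (D : ℝ) : (upShift reg D).a = reg.a := rfl

/-- The up-shift keeps the bare couplings. [folklore] -/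
@[simp] theorem upShift_β (reg : QCDRegularisation Nf) (D : ℝ) : (upShift reg D).β = reg.β := rfl

/-- The up-shift keeps the volumes. [folklore] -/
@[simp] theorem upShift_L (reg : QCDRegularisation Nf) (D : ℝ) : (upShift reg D).L = reg.L := rfl

/-- The up-shift keeps the mass renormalisation. [folklore] -/
@[simp] theorem upShift_Zm (reg : QCDRegularisation Nf) (D : ℝ) : (upShift reg D).Zm = reg.Zm := rfl

/-- The up-shifted critical mass, unfolded. [folklore] -/
@[simp] theorem upShift_mcrit (reg : QCDRegularisation Nf) (D : ℝ) (k : ℕ) :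
    (upShift reg D).mcrit k = reg.mcrit k + reg.a k * D / reg.Zm k := rfl

/-- The up-shifted scheme at tuple `m` IS the original scheme at tuple `D + m`. [folklore] -/
theorem upShift_scheme (reg : QCDRegularisation Nf) (D : ℝ) (m : Fin Nf → ℝ) (z shift : QCDField Nf → ℕ → ℝ) :
    (upShift reg D).scheme m z shift = reg.scheme (fun f => D + m f) z shift := by
  simp only [upShift, QCDRegularisation.scheme, QCDScheme.mk.injEq, true_and, and_true]
  funext f k
  ring

/-- The up-shift keeps mass scaling (which never reads `m_crit`). [folklore] -/
theorem hasMassScaling_upShift (reg : QCDRegularisation Nf) (D : ℝ) :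
    (upShift reg D).HasMassScaling ↔ reg.HasMassScaling := Iff.rfl

/-- The up-shift keeps asymptotic scaling (which reads only `β, a`). [folklore] -/
theorem hasAsymptoticScaling_upShift (reg : QCDRegularisation Nf) (D : ℝ) :
    ((upShift reg D).scheme 0 0 0).HasAsymptoticScaling ↔ (reg.scheme 0 0 0).HasAsymptoticScaling := Iff.rfl

/-- `m_crit → 0` survives the up-shift (`a_k D / Z_m(k) → 0` by mass scaling, `N_f ≤ 16`). [folklore] -/
theorem tendsto_mcrit_upShift (reg : QCDRegularisation Nf) (D : ℝ) (hNf : Nf ≤ 16) (hMS : reg.HasMassScaling)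
    (h : Tendsto reg.mcrit atTop (𝓝 0)) : Tendsto (upShift reg D).mcrit atTop (𝓝 0) := by
  have haz : Tendsto (fun k => reg.a k / reg.Zm k * D) atTop (𝓝 0) := by
    simpa using (tendsto_a_div_Zm reg hMS (massExponent_pos hNf)).mul_const D
  have hsum := h.add haz
  rw [add_zero] at hsum
  refine hsum.congr fun k => ?_
  show reg.mcrit k + reg.a k / reg.Zm k * D = reg.mcrit k + reg.a k * D / reg.Zm k
  ring

/-- **The lower pin is up-shift covariant**: the lower pin of `reg` above `M₀` with sea tuple `D + m` is the lower pin of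
`upShift reg D` above `M₀ + D` with sea tuple `m` (`D ≥ 0`; same bare data, offsets re-based). [folklore] -/
theorem pinClause_upShift {reg : QCDRegularisation Nf} {M₀ D : ℝ} {m : Fin Nf → ℝ} {R : ℝ}
    (h : PinClause Nf reg M₀ (fun f => D + m f) R) : PinClause Nf (upShift reg D) (M₀ + D) m R := by
  intro M hM
  have h1 : ∀ k, reg.mcrit k + reg.a k * D / reg.Zm k - reg.a k * M / reg.Zm k =
      reg.mcrit k - reg.a k * (M - D) / reg.Zm k := fun k => by ring
  have h2 : ∀ (k) (f : Fin Nf), reg.mcrit k + reg.a k * D / reg.Zm k + reg.a k * m f / reg.Zm k =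
      reg.mcrit k + reg.a k * (D + m f) / reg.Zm k := fun k f => by ring
  filter_upwards [h (M - D) (by linarith)] with k hk S hS
  have hk' := hk S hS
  simp only [upShift_a, upShift_β, upShift_mcrit, upShift_Zm, h1, h2] at hk' ⊢
  exact hk'

/-- **The upper pin is up-shift covariant** (same re-basing). [folklore] -/
theorem upperPin_upShift {reg : QCDRegularisation Nf} {M₀ D : ℝ} (hD : 0 ≤ D) {m : Fin Nf → ℝ} {R : ℝ}
    (h : UpperPin Nf reg M₀ (fun f => D + m f) R) : UpperPin Nf (upShift reg D) (M₀ + D) m R := by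
  intro M hM
  have h1 : ∀ k, reg.mcrit k + reg.a k * D / reg.Zm k + reg.a k * M / reg.Zm k =
      reg.mcrit k + reg.a k * (M + D) / reg.Zm k := fun k => by ring
  have h2 : ∀ (k) (f : Fin Nf), reg.mcrit k + reg.a k * D / reg.Zm k + reg.a k * m f / reg.Zm k =
      reg.mcrit k + reg.a k * (D + m f) / reg.Zm k := fun k f => by ring
  filter_upwards [h (M + D) (by linarith)] with k hk S hS hS2
  have hk' := hk S hS hS2
  simp only [upShift_a, upShift_β, upShift_mcrit, upShift_Zm, h1, h2] at hk' ⊢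
  exact hk'

/-- **The two-sided pin is up-shift covariant**: pin above `M₀` for `reg` ⇒ pin above `M₀ + D` for `upShift reg D` (`D ≥ 0`). [folklore] -/
theorem pinPkg_upShift {reg : QCDRegularisation Nf} {M₀ D : ℝ} (hD : 0 ≤ D) (h : PinPkg Nf reg M₀) :
    PinPkg Nf (upShift reg D) (M₀ + D) := by
  intro m hm
  obtain ⟨R, hR, hlo, hup⟩ := h (fun f => D + m f) fun f => by linarith [hm f]
  exact ⟨R, hR, pinClause_upShift hlo, upperPin_upShift hD hup⟩

/-- **The body is up-shift covariant**: body above `M₀` for `reg` ⇒ body above `M₁` for `upShift reg D` whenever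
`M₀ ≤ M₁ + D`. [folklore] -/
theorem body_upShift {reg : QCDRegularisation Nf} {M₀ M₁ D : ℝ} (hM : M₀ ≤ M₁ + D) (h : Body Nf reg M₀) :
    Body Nf (upShift reg D) M₁ := by
  intro m hm
  obtain ⟨z, shift, T, hQ, hN, hG, hP, Δ, hΔ, hT, hL⟩ := h (fun f => D + m f) fun f => by linarith [hm f]
  refine ⟨z, shift, T, ?_, hN, hG, hP, Δ, hΔ, hT, ?_⟩
  · rwa [upShift_scheme]
  · rwa [upShift_scheme]

/-- **After the up-shift by `D > M₀` the weak branch is AUTOMATIC**: the body's own branch clause at the tuple `D·1` gives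
`−1 < m_crit k + a_k D / Z_m k = (upShift reg D).mcrit k` eventually (`N_f ≠ 0` to name a flavour). [folklore] -/
theorem body_branch_upShift [NeZero Nf] {reg : QCDRegularisation Nf} {M₀ D : ℝ} (h : Body Nf reg M₀) (hD : M₀ < D) :
    ∀ᶠ k : ℕ in atTop, -1 ≤ (upShift reg D).mcrit k := by
  have hf := body_branch_sliver h (fun _ => D) (fun _ => hD) (0 : Fin Nf)
  filter_upwards [hf] with k hk
  rw [upShift_mcrit]
  exact hk.le

/-- **The weak branch is idle**: the crux with hypothesis 3 deleted. -/
def WithoutBranch : Prop :=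
  ∀ Nf : ℕ, (Nf = 2 ∨ Nf = 3) → ∀ reg : QCDRegularisation Nf, reg.HasMassScaling →
    (reg.scheme 0 0 0).HasAsymptoticScaling → ∀ M₀ : ℝ, 0 ≤ M₀ → PinPkg Nf reg M₀ → Body Nf reg M₀ → Concl Nf

/-- **`LightQuarkCompletion ↔ WithoutBranch`.**  Given the package WITHOUT the weak branch at `(reg, M₀)`, the up-shift
`reg₂ := upShift reg (M₀ + 1)` carries both scalings, the pin above `2M₀ + 1`, the body above `2M₀ + 1` AND the weak branch
(from the body's IsQCDAlong clause at the tuple `(M₀+1)·1`), so the crux applies to `reg₂` — and its conclusion is `reg`-free.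
Consequence for the line: the binder `hbr` threads no information that `hbody` does not already carry (at RGI precision). [folklore] -/
theorem lightQuarkCompletion_iff_withoutBranch : LightQuarkCompletion ↔ WithoutBranch := by
  rw [lightQuarkCompletion_iff]
  constructor
  · intro h Nf hNf reg hMS hAS M₀ hM₀ hpin hbody
    haveI : NeZero Nf := ⟨by rcases hNf with rfl | rfl <;> norm_num⟩
    have hbr₂ := body_branch_upShift (D := M₀ + 1) hbody (by linarith)
    refine h Nf hNf (upShift reg (M₀ + 1)) (M₀ + (M₀ + 1))
      ⟨(hasMassScaling_upShift reg _).mpr hMS, (hasAsymptoticScaling_upShift reg _).mpr hAS, hbr₂, by linarith,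
        pinPkg_upShift (by linarith) hpin, body_upShift (by linarith) hbody⟩
  · rintro h Nf hNf reg M₀ ⟨hMS, hAS, -, hM₀, hpin, hbody⟩
    exact h Nf hNf reg hMS hAS M₀ hM₀ hpin hbody

end Summit.QuantumFields.QCD.Theorems.LightQuarkCompletion.Negative

end
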